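import Summits.ValiantsHypothesis.ValiantsHypothesis.Theorems.LacunarySymmetroidMatrixDescartesDoorA26WallBubblingNoBalance
import Summits.ValiantsHypothesis.ValiantsHypothesis.Theorems.LacunarySymmetroidMatrixDescartesDoorA26WallBubblingExpSumLocalSigns

/-!
# `DoorA26` / line `wall_bubbling` — HONEST ENCODING: every rank-one double-zero profile of total multiplicity twenty sits on 21
alternating abscissae, hence LIFTS (the encoding side conditions of #55 are w.l.o.g.)

HONEST FRAMING.  Object-search cell `pub-symmetroid`, crux `Theses.LacunarySymmetroid.DoorA26` (stmt-ValiantsHypothesis-19979; OPEN, typed,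
never asserted).  W2 seat val-sym-door-p1 g19, file #57; def-free helper for obligation (R) of `Cruxes/DoorA26/Lines/wall_bubbling.lean`, answering
desk R3201 (A)'s question on #55 `mem_twentyLocus_of_rankOne_touches` («is the honest encoding — first/last abscissa non-touch, no two adjacent touch
indices — w.l.o.g.?»): YES, for every profile of the rank-one double-zero class, in the kernel.

WHAT IS HERE (on #56 `…ExpSumLocalSigns`: `expSum_sign_near_simple/double`, `mul_pos_of_no_zero`).  ★★ `mem_twentyLocus_of_rankOne_profile`:
strictly increasing exponents, symmetric letters, `F = det P` (an exponential sum by #50 `det_expPencil_eq_expSum_fun`) with strictly increasing real zeros `z : Fin r → ℝ`, a set `D` of double ones, `r + |D| = 20`, NO other real zeros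
(`F t = 0 ↔ t ∈ range z`), `F′(z_i) ≠ 0` off `D`, `F′(z_i) = 0 ≠ F″(z_i)` (`deriv`, `iteratedDeriv 2`) and `tr P(z_i) ≠ 0` on `D` ⇒ `δ ∈ TwentyLocus`.
CONSTRUCTION: the 21 abscissae are the `r + 1` GAP POINTS (`g_0 = z_0 − 1`, midpoints of consecutive zeros, `g_r = z_{r−1} + 1`) and the `|D|` double
zeros, enumerated increasingly (`Finset.orderEmbOfFin`); touches `J` = the double zeros; `κ = F` at a gap point, `−F″` at a double zero.  Then `0, 20 ∉ J`
(the extreme abscissae are gap points), no two touches are adjacent (the gap point `g_{m+1}` separates `z_m` from the next zero), `κ_j det P(τ_j) = F² > 0`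
off `J`, and consecutive abscissae ALTERNATE: the successor of `g_i` is `z_i` if `i ∈ D` (signs `F(g_i) ~ F″(z_i)` vs `−F″(z_i)`) and `g_{i+1}` if not
(`F(g_i) ~ −F′(z_i)`, `F(g_{i+1}) ~ F′(z_i)`); the successor of a touch `z_m` is `g_{m+1}` (`−F″` vs `F(g_{m+1}) ~ F″`) — each read through #56 at the zero
and propagated to the gap point across a zero-free interval.  Then #55 applies.
READING for (R): the single-cluster multiplicity residual of (R) restricted to profiles whose multiple zeros are all RANK-ONE DOUBLE zeros is EMPTY
OUTRIGHT (no encoding proviso): such a limit pencil at `δ⋆` lifts, `δ⋆ ∈ TwentyLocus`.  Left in the single-cluster residual: rank-ZERO zeros (`P(z) = 0`;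
#46's second-order clause pointwise) and zeros of order `≥ 3` (#49/#50 for one triple zero; `≥ 4` untyped).  Nothing here bears on `DoorA26`, `DoorA34`,
(W)/(M)/(R) as typed, `MatrixDescartes` (18050) or `VP ≠ VNP`; registers unchanged.

[folklore] first/second derivative tests; intermediate value theorem.  [this work] the encoding and its bookkeeping.
-/

set_option linter.dupNamespace false

namespace Summit.ValiantsHypothesis.ValiantsHypothesis.Theorems.LacunarySymmetroidMatrixDescartes.WallBubbling

open Finset Filter Topology
open Bubbling (TwentyLocus polar expSum hasDerivAt_expSum)

/-! ## The honest encoding of a rank-one double-zero profile -/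

/-- **EVERY RANK-ONE DOUBLE-ZERO PROFILE LIFTS** (the honest encoding is w.l.o.g.).  Strictly increasing exponents, symmetric
letters, and the zero data of `F = det P`: strictly increasing distinct real zeros `z : Fin r → ℝ`, a set `D` of DOUBLE ones with
`r + |D| = 20` (total multiplicity twenty), no other real zeros (`F t = 0 ↔ t ∈ range z`), `F′(z_i) ≠ 0` off `D`, and on `D`
`F′(z_i) = 0 ≠ F″(z_i)` with `tr P(z_i) ≠ 0` (rank-one double zeros).  Then `δ ∈ TwentyLocus`.  Construction: the `21` abscissae are the
`r + 1` GAP POINTS `g_i` (strictly between consecutive zeros, one below all, one above all) and the `|D|` double zeros; `κ` is `F` at a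
gap point and `−F″` at a double zero; the first/last abscissae are gap points, two touches are never adjacent (a gap point separates
consecutive zeros), and consecutive abscissae alternate by the local sign lemmas of §1 — so #55 `mem_twentyLocus_of_rankOne_touches`
applies. [this work] -/
theorem mem_twentyLocus_of_rankOne_profile (δ : Fin 6 → ℝ) (hd : StrictMono δ) (S : Fin 6 → Matrix (Fin 2) (Fin 2) ℝ)
    (hS : ∀ l, (S l).IsSymm) {r : ℕ} (z : Fin r → ℝ) (hz : StrictMono z) (D : Finset (Fin r))
    (hcount : r + D.card = 20)
    (hzero : ∀ t, (∑ l, Real.exp (δ l * t) • S l).det = 0 ↔ t ∈ Set.range z)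
    (hsimple : ∀ i ∉ D, deriv (fun t => (∑ l, Real.exp (δ l * t) • S l).det) (z i) ≠ 0)
    (hdouble : ∀ i ∈ D, deriv (fun t => (∑ l, Real.exp (δ l * t) • S l).det) (z i) = 0 ∧
      iteratedDeriv 2 (fun t => (∑ l, Real.exp (δ l * t) • S l).det) (z i) ≠ 0 ∧
      (∑ l, Real.exp (δ l * z i) • S l).trace ≠ 0) :
    δ ∈ TwentyLocus := by
  classical
  -- `r ≥ 10`
  have hDr : D.card ≤ r := by simpa using Finset.card_le_univ D
  have hr : 0 < r := by omega
  -- `F` as an exponential sum, with its first two derivatives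
  set F : ℝ → ℝ := fun t => (∑ l, Real.exp (δ l * t) • S l).det with hFdef
  obtain ⟨A, X, hFAX⟩ : ∃ (A X : Equiv.Perm (Fin 2) × (Fin 2 → Fin 6) → ℝ), F = expSum A X :=
    ⟨_, _, det_expPencil_eq_expSum_fun δ S⟩
  set F' : ℝ → ℝ := expSum (fun i => A i * X i) X with hF'
  set F'' : ℝ → ℝ := expSum (fun i => A i * X i * X i) X with hF''
  have hderiv : deriv F = F' := by rw [hFAX]; exact deriv_expSum_eq A X
  have hderiv2 : iteratedDeriv 2 F = F'' := by
    rw [hFAX, iteratedDeriv_expSum]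
    show expSum (fun i => A i * X i ^ 2) X = expSum (fun i => A i * X i * X i) X
    congr 1; funext i; ring
  have hFcont : Continuous F := by rw [hFAX]; exact continuous_expSum A X
  have hFz : ∀ t, F t = 0 ↔ ∃ m, z m = t := fun t => by rw [hFdef]; exact (hzero t).trans Set.mem_range
  -- gap points
  set g : Fin (r + 1) → ℝ := fun i =>
    ((if (i : ℕ) = 0 then z ⟨0, hr⟩ - 2 else z ⟨(i : ℕ) - 1, by omega⟩) +
      (if h : (i : ℕ) < r then z ⟨i, h⟩ else z ⟨r - 1, by omega⟩ + 2)) / 2 with hg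
  have hgU : ∀ (i : Fin (r + 1)) (m : Fin r), (i : ℕ) ≤ m → g i < z m := by
    intro i m him
    have hir : (i : ℕ) < r := lt_of_le_of_lt him m.2
    have h2 : (if h : (i : ℕ) < r then z ⟨i, h⟩ else z ⟨r - 1, by omega⟩ + 2) ≤ z m := by
      rw [dif_pos hir]; exact hz.monotone (Fin.le_def.2 (by show (i : ℕ) ≤ m; exact him))
    have h1 : (if (i : ℕ) = 0 then z ⟨0, hr⟩ - 2 else z ⟨(i : ℕ) - 1, by omega⟩) < z m := by
      split_ifs with h0
      · have := hz.monotone (show (⟨0, hr⟩ : Fin r) ≤ m from Fin.le_def.2 (by show 0 ≤ (m : ℕ); omega))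
        linarith
      · exact hz (show (⟨(i : ℕ) - 1, _⟩ : Fin r) < m from Fin.lt_def.2 (by show (i : ℕ) - 1 < m; omega))
    show ((if (i : ℕ) = 0 then z ⟨0, hr⟩ - 2 else z ⟨(i : ℕ) - 1, by omega⟩) +
      (if h : (i : ℕ) < r then z ⟨i, h⟩ else z ⟨r - 1, by omega⟩ + 2)) / 2 < z m
    linarith
  have hgL : ∀ (i : Fin (r + 1)) (m : Fin r), (m : ℕ) < i → z m < g i := by
    intro i m hmi
    have h1 : z m ≤ (if (i : ℕ) = 0 then z ⟨0, hr⟩ - 2 else z ⟨(i : ℕ) - 1, by omega⟩) := by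
      rw [if_neg (by omega)]
      exact hz.monotone (Fin.le_def.2 (by show (m : ℕ) ≤ (i : ℕ) - 1; omega))
    have h2 : z m < (if h : (i : ℕ) < r then z ⟨i, h⟩ else z ⟨r - 1, by omega⟩ + 2) := by
      split_ifs with hir
      · exact hz (Fin.lt_def.2 (by show (m : ℕ) < (i : ℕ); exact hmi))
      · have := hz.monotone (show m ≤ ⟨r - 1, by omega⟩ from Fin.le_def.2 (by show (m : ℕ) ≤ r - 1; omega))
        linarith
    show z m < ((if (i : ℕ) = 0 then z ⟨0, hr⟩ - 2 else z ⟨(i : ℕ) - 1, by omega⟩) +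
      (if h : (i : ℕ) < r then z ⟨i, h⟩ else z ⟨r - 1, by omega⟩ + 2)) / 2
    linarith
  have hgmono : StrictMono g := by
    intro i i' hii'
    have hir : (i : ℕ) < r := by have := i'.2; rw [Fin.lt_def] at hii'; omega
    exact (hgU i ⟨i, hir⟩ le_rfl).trans (hgL i' ⟨i, hir⟩ (Fin.lt_def.1 hii'))
  have hgz : ∀ i m, g i ≠ z m := by
    intro i m h
    rcases le_or_gt (i : ℕ) m with him | hmi
    · exact absurd h (ne_of_lt (hgU i m him))
    · exact absurd h (ne_of_gt (hgL i m hmi))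
  have hFg : ∀ i, F (g i) ≠ 0 := fun i h => by obtain ⟨m, hm⟩ := (hFz _).1 h; exact hgz i m hm.symm
  -- the 21 abscissae
  set TAU : Finset ℝ := (Finset.univ.image g) ∪ (D.image z) with hTAU
  have hmemTAU : ∀ x, x ∈ TAU ↔ (∃ i, g i = x) ∨ (∃ m ∈ D, z m = x) := fun x => by
    simp [hTAU]
  have hdisj : Disjoint (Finset.univ.image g) (D.image z) := by
    rw [Finset.disjoint_left]
    intro x hx hx'
    obtain ⟨i, -, rfl⟩ := Finset.mem_image.1 hx
    obtain ⟨m, -, hm⟩ := Finset.mem_image.1 hx'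
    exact hgz i m hm.symm
  have hcard : TAU.card = 21 := by
    rw [hTAU, Finset.card_union_of_disjoint hdisj, Finset.card_image_of_injective _ hgmono.injective,
      Finset.card_image_of_injective _ hz.injective, Finset.card_univ, Fintype.card_fin]
    omega
  set τ : Fin 21 ↪o ℝ := TAU.orderEmbOfFin hcard with hτdef
  have hτmem : ∀ j, τ j ∈ TAU := fun j => TAU.orderEmbOfFin_mem hcard j
  have hτsurj : ∀ x ∈ TAU, ∃ j, τ j = x := fun x hx => by
    have : x ∈ Set.range τ := by rw [hτdef, Finset.range_orderEmbOfFin]; exact hx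
    exact this
  -- touches and virtual signs
  set J : Finset (Fin 21) := Finset.univ.filter fun j => ∃ m ∈ D, z m = τ j with hJ
  have hmemJ : ∀ j, j ∈ J ↔ ∃ m ∈ D, z m = τ j := fun j => by simp [hJ]
  set κ : Fin 21 → ℝ := fun j => if ∃ m ∈ D, z m = τ j then -F'' (τ j) else F (τ j) with hκ
  -- a non-touch abscissa is a gap point
  have hgap : ∀ j, j ∉ J → ∃ i, g i = τ j := by
    intro j hj
    rcases (hmemTAU _).1 (hτmem j) with h | ⟨m, hm, h⟩
    · exact h
    · exact absurd ((hmemJ j).2 ⟨m, hm, h⟩) hj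
  -- consecutive abscissae: nothing of `TAU` strictly between
  have hconsec : ∀ (j : Fin 20) (x : ℝ), x ∈ TAU → τ j.castSucc < x → x < τ j.succ → False := by
    intro j x hx h1 h2
    obtain ⟨m, rfl⟩ := hτsurj x hx
    have h1' : j.castSucc < m := τ.lt_iff_lt.1 h1
    have h2' : m < j.succ := τ.lt_iff_lt.1 h2
    rw [Fin.lt_def, Fin.val_castSucc] at h1'
    rw [Fin.lt_def, Fin.val_succ] at h2'
    omega
  -- the next abscissa after `τ j.castSucc` is the least element of `TAU` above it
  have hnext : ∀ (j : Fin 20) (c : ℝ), c ∈ TAU → τ j.castSucc < c → (∀ x ∈ TAU, τ j.castSucc < x → c ≤ x) →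
      τ j.succ = c := by
    intro j c hc hac hmin
    have hab : τ j.castSucc < τ j.succ := τ.strictMono Fin.castSucc_lt_succ
    have h1 : c ≤ τ j.succ := hmin _ (hτmem _) hab
    rcases eq_or_lt_of_le h1 with h | h
    · exact h.symm
    · exact (hconsec j c hc hac h).elim
  -- local signs at the zeros, read at the neighbouring gap points
  have hright : ∀ (i : Fin (r + 1)) (m : Fin r), (m : ℕ) + 1 = i →
      (m ∉ D → 0 < F' (z m) * F (g i)) ∧ (m ∈ D → 0 < F'' (z m) * F (g i)) := by
    intro i m hmi
    have hzg : z m < g i := hgL i m (by omega)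
    -- no zero of `F` in `(z m, g i]`
    have hnoz : ∀ u, z m < u → u ≤ g i → F u ≠ 0 := by
      intro u hu1 hu2 hFu
      obtain ⟨m', hm'⟩ := (hFz u).1 hFu
      rcases le_or_gt (i : ℕ) m' with h | h
      · have := hgU i m' h; rw [hm'] at this; linarith
      · have hm'm : m' ≤ m := Fin.le_def.2 (by omega)
        have := hz.monotone hm'm; rw [hm'] at this; linarith
    constructor
    · intro hmD
      have hzF : expSum A X (z m) = 0 := by rw [← hFAX]; exact (hFz _).2 ⟨m, rfl⟩
      have hdF : expSum (fun i => A i * X i) X (z m) ≠ 0 := by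
        have := hsimple m hmD; rw [hderiv] at this
        exact this
      obtain ⟨η, hη, hR, -⟩ := expSum_sign_near_simple A X (z m) hzF hdF
      set t := z m + min (η / 2) ((g i - z m) / 2) with ht
      have ht1 : z m < t := by have := lt_min (half_pos hη) (half_pos (sub_pos.2 hzg)); linarith
      have ht2 : t < z m + η := by have := min_le_left (η / 2) ((g i - z m) / 2); linarith
      have ht3 : t ≤ g i := by have := min_le_right (η / 2) ((g i - z m) / 2); linarith
      have hs1 := hR t ht1 ht2
      rw [← hFAX] at hs1
      have hs2 := mul_pos_of_no_zero hFcont ht3 (fun u hu1 hu2 => hnoz u (lt_of_lt_of_le ht1 hu1) hu2)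
      have : 0 < (F' (z m) * F (g i)) * (F t * F t) := by nlinarith
      exact pos_of_mul_pos_left this (mul_self_nonneg _)
    · intro hmD
      obtain ⟨hd1, hd2, -⟩ := hdouble m hmD
      rw [hderiv] at hd1
      rw [hderiv2] at hd2
      have hzF : expSum A X (z m) = 0 := by rw [← hFAX]; exact (hFz _).2 ⟨m, rfl⟩
      obtain ⟨η, hη, hN⟩ := expSum_sign_near_double A X (z m) hzF hd1 hd2
      set t := z m + min (η / 2) ((g i - z m) / 2) with ht
      have ht1 : z m < t := by have := lt_min (half_pos hη) (half_pos (sub_pos.2 hzg)); linarith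
      have ht2 : t < z m + η := by have := min_le_left (η / 2) ((g i - z m) / 2); linarith
      have ht3 : t ≤ g i := by have := min_le_right (η / 2) ((g i - z m) / 2); linarith
      have hs1 := hN t (by linarith) ht2 (ne_of_gt ht1)
      rw [← hFAX] at hs1
      have hs2 := mul_pos_of_no_zero hFcont ht3 (fun u hu1 hu2 => hnoz u (lt_of_lt_of_le ht1 hu1) hu2)
      have : 0 < (F'' (z m) * F (g i)) * (F t * F t) := by nlinarith
      exact pos_of_mul_pos_left this (mul_self_nonneg _)
  have hleft : ∀ (i : Fin (r + 1)) (m : Fin r), (m : ℕ) = i →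
      (m ∉ D → F' (z m) * F (g i) < 0) ∧ (m ∈ D → 0 < F'' (z m) * F (g i)) := by
    intro i m hmi
    have hgzl : g i < z m := hgU i m (by omega)
    have hnoz : ∀ u, g i ≤ u → u < z m → F u ≠ 0 := by
      intro u hu1 hu2 hFu
      obtain ⟨m', hm'⟩ := (hFz u).1 hFu
      rcases lt_or_ge (m' : ℕ) i with h | h
      · have := hgL i m' h; rw [hm'] at this; linarith
      · have hmm' : m ≤ m' := Fin.le_def.2 (by omega)
        have := hz.monotone hmm'; rw [hm'] at this; linarith
    constructor
    · intro hmD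
      have hzF : expSum A X (z m) = 0 := by rw [← hFAX]; exact (hFz _).2 ⟨m, rfl⟩
      have hdF : expSum (fun i => A i * X i) X (z m) ≠ 0 := by
        have := hsimple m hmD; rw [hderiv] at this
        exact this
      obtain ⟨η, hη, -, hL⟩ := expSum_sign_near_simple A X (z m) hzF hdF
      set t := z m - min (η / 2) ((z m - g i) / 2) with ht
      have ht1 : t < z m := by have := lt_min (half_pos hη) (half_pos (sub_pos.2 hgzl)); linarith
      have ht2 : z m - η < t := by have := min_le_left (η / 2) ((z m - g i) / 2); linarith
      have ht3 : g i ≤ t := by have := min_le_right (η / 2) ((z m - g i) / 2); linarith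
      have hs1 := hL t ht2 ht1
      rw [← hFAX] at hs1
      have hs2 := mul_pos_of_no_zero hFcont ht3 (fun u hu1 hu2 => hnoz u hu1 (lt_of_le_of_lt hu2 ht1))
      have : (F' (z m) * F (g i)) * (F t * F t) < 0 := by nlinarith
      by_contra hge
      exact absurd this (not_lt.2 (mul_nonneg (not_lt.1 hge) (mul_self_nonneg _)))
    · intro hmD
      obtain ⟨hd1, hd2, -⟩ := hdouble m hmD
      rw [hderiv] at hd1
      rw [hderiv2] at hd2
      have hzF : expSum A X (z m) = 0 := by rw [← hFAX]; exact (hFz _).2 ⟨m, rfl⟩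
      obtain ⟨η, hη, hN⟩ := expSum_sign_near_double A X (z m) hzF hd1 hd2
      set t := z m - min (η / 2) ((z m - g i) / 2) with ht
      have ht1 : t < z m := by have := lt_min (half_pos hη) (half_pos (sub_pos.2 hgzl)); linarith
      have ht2 : z m - η < t := by have := min_le_left (η / 2) ((z m - g i) / 2); linarith
      have ht3 : g i ≤ t := by have := min_le_right (η / 2) ((z m - g i) / 2); linarith
      have hs1 := hN t ht2 (by linarith) (ne_of_lt ht1)
      rw [← hFAX] at hs1
      have hs2 := mul_pos_of_no_zero hFcont ht3 (fun u hu1 hu2 => hnoz u hu1 (lt_of_le_of_lt hu2 ht1))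
      have : 0 < (F'' (z m) * F (g i)) * (F t * F t) := by nlinarith
      exact pos_of_mul_pos_left this (mul_self_nonneg _)
  -- APPLY #55
  refine mem_twentyLocus_of_rankOne_touches δ hd S hS τ τ.strictMono κ J ?_ ?_ ?_ ?_ ?_ ?_
  · -- hoff
    intro j hj
    obtain ⟨i, hi⟩ := hgap j hj
    have hnot : ¬ ∃ m ∈ D, z m = τ j := fun h => hj ((hmemJ j).2 h)
    show 0 < (if ∃ m ∈ D, z m = τ j then -F'' (τ j) else F (τ j)) * F (τ j)
    rw [if_neg hnot, ← hi]
    exact mul_self_pos.2 (hFg i)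
  · -- hon
    intro j hj
    obtain ⟨m, hm, hmj⟩ := (hmemJ j).1 hj
    refine ⟨?_, ?_⟩
    · show F (τ j) = 0
      exact (hFz _).2 ⟨m, hmj⟩
    · rw [← hmj]; exact (hdouble m hm).2.2
  · -- halt
    intro j
    have hcs := hτmem j.castSucc
    rcases (hmemTAU _).1 hcs with ⟨i, hi⟩ | ⟨m, hmD, hm⟩
    · -- `τ j.castSucc = g i`, with `i < r`
      have hir : (i : ℕ) < r := by
        by_contra hge
        have hab : τ j.castSucc < τ j.succ := τ.strictMono Fin.castSucc_lt_succ
        rcases (hmemTAU _).1 (hτmem j.succ) with ⟨i', hi'⟩ | ⟨m', -, hm'⟩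
        · have : g i' ≤ g i := hgmono.monotone (Fin.le_def.2 (by have := i'.2; omega))
          rw [hi, hi'] at this; exact absurd hab (not_lt.2 this)
        · have := hgL i m' (by omega); rw [hi, hm'] at this; exact absurd hab (not_lt.2 this.le)
      have hnotcs : ¬ ∃ m ∈ D, z m = τ j.castSucc := by
        rintro ⟨m, -, hm⟩; exact hgz i m (hi.trans hm.symm)
      by_cases hiD : (⟨i, hir⟩ : Fin r) ∈ D
      · -- next abscissa is the touch `z i`
        have hsucc : τ j.succ = z ⟨i, hir⟩ := by
          refine hnext j _ ((hmemTAU _).2 (Or.inr ⟨_, hiD, rfl⟩)) (by rw [← hi]; exact hgU i _ le_rfl) ?_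
          intro x hx hax
          rw [← hi] at hax
          rcases (hmemTAU x).1 hx with ⟨i', rfl⟩ | ⟨m', -, rfl⟩
          · have : i < i' := hgmono.lt_iff_lt.1 hax
            exact (hgL i' ⟨i, hir⟩ (Fin.lt_def.1 this)).le
          · refine hz.monotone (Fin.le_def.2 ?_)
            by_contra h; push Not at h
            exact absurd hax (not_lt.2 (hgL i m' (by simpa using h)).le)
        have htouch : ∃ m ∈ D, z m = τ j.succ := ⟨_, hiD, hsucc.symm⟩
        show (if ∃ m ∈ D, z m = τ j.castSucc then -F'' (τ j.castSucc) else F (τ j.castSucc)) *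
          (if ∃ m ∈ D, z m = τ j.succ then -F'' (τ j.succ) else F (τ j.succ)) < 0
        rw [if_neg hnotcs, if_pos htouch, hsucc, ← hi]
        have := (hleft i ⟨i, hir⟩ rfl).2 hiD
        nlinarith
      · -- next abscissa is the gap point `g (i+1)`; `z i` is a simple zero in between
        set i1 : Fin (r + 1) := ⟨(i : ℕ) + 1, by omega⟩ with hi1
        have hsucc : τ j.succ = g i1 := by
          refine hnext j _ ((hmemTAU _).2 (Or.inl ⟨i1, rfl⟩)) (by rw [← hi]; exact hgmono (Fin.lt_def.2 (by simp [hi1])))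
            ?_
          intro x hx hax
          rw [← hi] at hax
          rcases (hmemTAU x).1 hx with ⟨i', rfl⟩ | ⟨m', hm'D, rfl⟩
          · have : i < i' := hgmono.lt_iff_lt.1 hax
            exact hgmono.monotone (Fin.le_def.2 (by rw [Fin.lt_def] at this; simp [hi1]; omega))
          · have hmi : (i : ℕ) ≤ m' := by
              by_contra h; push Not at h
              exact absurd hax (not_lt.2 (hgL i m' h).le)
            have hne : (m' : ℕ) ≠ i := fun h => hiD (by
              have : m' = ⟨i, hir⟩ := Fin.ext h
              rw [← this]; exact hm'D)
            exact (hgU i1 m' (by simp [hi1]; omega)).le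
        have hnotsucc : ¬ ∃ m ∈ D, z m = τ j.succ := by
          rintro ⟨m, -, hm⟩; exact hgz i1 m (hm.trans hsucc).symm
        show (if ∃ m ∈ D, z m = τ j.castSucc then -F'' (τ j.castSucc) else F (τ j.castSucc)) *
          (if ∃ m ∈ D, z m = τ j.succ then -F'' (τ j.succ) else F (τ j.succ)) < 0
        rw [if_neg hnotcs, if_neg hnotsucc, hsucc, ← hi]
        have h1 := (hleft i ⟨i, hir⟩ rfl).1 hiD
        have h2 := (hright i1 ⟨i, hir⟩ (by simp [hi1])).1 hiD
        have h3 := mul_neg_of_neg_of_pos h1 h2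
        by_contra hge
        have h4 : 0 ≤ F (g i) * F (g i1) * (F' (z ⟨i, hir⟩) * F' (z ⟨i, hir⟩)) :=
          mul_nonneg (not_lt.1 hge) (mul_self_nonneg _)
        have : F' (z ⟨i, hir⟩) * F (g i) * (F' (z ⟨i, hir⟩) * F (g i1)) =
            F (g i) * F (g i1) * (F' (z ⟨i, hir⟩) * F' (z ⟨i, hir⟩)) := by ring
        linarith
    · -- `τ j.castSucc = z m` is a touch; next abscissa is `g (m+1)`
      set i1 : Fin (r + 1) := ⟨(m : ℕ) + 1, by omega⟩ with hi1
      have hsucc : τ j.succ = g i1 := by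
        refine hnext j _ ((hmemTAU _).2 (Or.inl ⟨i1, rfl⟩)) (by rw [← hm]; exact hgL i1 m (by simp [hi1])) ?_
        intro x hx hax
        rw [← hm] at hax
        rcases (hmemTAU x).1 hx with ⟨i', rfl⟩ | ⟨m', -, rfl⟩
        · have : (m : ℕ) < i' := by
            by_contra h; push Not at h
            exact absurd hax (not_lt.2 (hgU i' m h).le)
          exact hgmono.monotone (Fin.le_def.2 (by simp [hi1]; omega))
        · have : m < m' := hz.lt_iff_lt.1 hax
          exact (hgU i1 m' (by rw [Fin.lt_def] at this; simp [hi1]; omega)).le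
      have htouch : ∃ m' ∈ D, z m' = τ j.castSucc := ⟨m, hmD, hm⟩
      have hnotsucc : ¬ ∃ m' ∈ D, z m' = τ j.succ := by
        rintro ⟨m', -, hm'⟩; exact hgz i1 m' (hm'.trans hsucc).symm
      show (if ∃ m ∈ D, z m = τ j.castSucc then -F'' (τ j.castSucc) else F (τ j.castSucc)) *
        (if ∃ m ∈ D, z m = τ j.succ then -F'' (τ j.succ) else F (τ j.succ)) < 0
      rw [if_pos htouch, if_neg hnotsucc, hsucc, ← hm]
      have := (hright i1 m (by simp [hi1])).2 hmD
      nlinarith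
  · -- h0: the first abscissa is the lowest gap point
    intro h0
    obtain ⟨m, -, hm⟩ := (hmemJ 0).1 h0
    have hle : τ 0 ≤ g 0 := by
      obtain ⟨j, hj⟩ := hτsurj (g 0) ((hmemTAU _).2 (Or.inl ⟨0, rfl⟩))
      rw [← hj]; exact τ.monotone (Fin.zero_le _)
    have := hgU 0 m (Nat.zero_le _)
    rw [← hm] at hle; linarith
  · -- h20: the last abscissa is the highest gap point
    intro h20
    obtain ⟨m, -, hm⟩ := (hmemJ (Fin.last 20)).1 h20
    have hle : g (Fin.last r) ≤ τ (Fin.last 20) := by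
      obtain ⟨j, hj⟩ := hτsurj (g (Fin.last r)) ((hmemTAU _).2 (Or.inl ⟨_, rfl⟩))
      rw [← hj]; exact τ.monotone (Fin.le_last _)
    have := hgL (Fin.last r) m (by rw [Fin.val_last]; exact m.2)
    rw [← hm] at hle; linarith
  · -- hsep: a touch is followed by a gap point
    intro j hj hj'
    obtain ⟨m, hmD, hm⟩ := (hmemJ _).1 hj
    obtain ⟨m', -, hm'⟩ := (hmemJ _).1 hj'
    set i1 : Fin (r + 1) := ⟨(m : ℕ) + 1, by omega⟩ with hi1
    -- `g (m+1)` lies strictly between the two touches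
    have h1 : τ j.castSucc < g i1 := by rw [← hm]; exact hgL i1 m (by simp [hi1])
    have hlt : τ j.castSucc < τ j.succ := τ.strictMono Fin.castSucc_lt_succ
    have h2 : g i1 < τ j.succ := by
      rw [← hm']
      have : m < m' := hz.lt_iff_lt.1 (by rw [hm, hm']; exact hlt)
      exact hgU i1 m' (by rw [Fin.lt_def] at this; simp [hi1]; omega)
    exact hconsec j (g i1) ((hmemTAU _).2 (Or.inl ⟨i1, rfl⟩)) h1 h2

end Summit.ValiantsHypothesis.ValiantsHypothesis.Theorems.LacunarySymmetroidMatrixDescartes.WallBubbling
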